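import Summits.PneNP.PneNP.Theses.KarlinRubin
import Summits.PneNP.PneNP.Theorems.KarlinRubinMonotoneSufficesBruteForce

/-!
# Crux `MonotoneSuffices` (stmt-PneNP-18026), line `slice-transport` — stub `stub_bruteForce`

The registered stub `stub_bruteForce` of the skeleton
`Summits/PneNP/PneNP/Cruxes/MonotoneSuffices/Lines/slice_transport.lean`: ONE family `M n` of
`{∧₂, ∨₂, 0, 1}`-circuits with `|M n| ≤ 2^{c₄ ⌊log₂ n⌋²}` eventually whose unconditional error sum
(type I under `G(n,1/2)` + type II under the planted `⌈n^{1/2-δ}⌉`-clique) tends to `0` for EVERY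
`δ ∈ (0,1/2)`. The family is the exact monotone `CLIQUE(n, 3⌊log₂ n⌋+3)` circuit of
`KarlinRubinMonotoneSufficesBruteForce.lean` (`exists_sized_monotone_cliqueCircuit`, `≤ n^{t+2}` gates),
which does not depend on `δ`; `n^{3L+5} ≤ (2^{L+1})^{3L+5} ≤ 2^{16 L²}` for `L = ⌊log₂ n⌋ ≥ 1` gives
`c₄ = 16`. Type I `→ 0` by the proved first-moment item (`plantedClique_erdosRenyiNoLargeClique_proof`),
type II `= 0` eventually (`eventually_three_log_le_rpow`, `mem_support_plantedCliqueJoint`).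
-/

set_option linter.dupNamespace false -- `Summit.PneNP.PneNP.…`: summit = sub-problem name (D-0017 single-conjunct layout)

namespace Summit.PneNP.PneNP.Theorems.MonotoneSuffices.SliceTransport

open Literature.Computability.Complexity Literature.Probability.RandomGraphs.PlantedClique Filter Finset
open Summit.PneNP.PneNP.Theorems

/-- `n^{3⌊log₂ n⌋ + 5} ≤ 2^{16 ⌊log₂ n⌋²}` for `n ≥ 2`. [folklore] -/
theorem pow_three_log_add_five_le (n : ℕ) (hn : 2 ≤ n) :
    n ^ (3 * Nat.log 2 n + 5) ≤ 2 ^ (16 * Nat.log 2 n ^ 2) := by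
  set L := Nat.log 2 n with hL
  have hL1 : 1 ≤ L := by
    rw [hL]
    exact Nat.le_log_of_pow_le (by norm_num) (by simpa using hn)
  have hnle : n ≤ 2 ^ (L + 1) := (Nat.lt_pow_succ_log_self (by norm_num : 1 < 2) n).le
  have hexp : (L + 1) * (3 * L + 5) ≤ 16 * L ^ 2 := by nlinarith
  calc n ^ (3 * L + 5) ≤ (2 ^ (L + 1)) ^ (3 * L + 5) := Nat.pow_le_pow_left hnle _
    _ = 2 ^ ((L + 1) * (3 * L + 5)) := by rw [← pow_mul]
    _ ≤ 2 ^ (16 * L ^ 2) := Nat.pow_le_pow_right (by norm_num) hexp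

/-- **stub_bruteForce** (registered stub of line `slice-transport`, crux stmt-PneNP-18026): there are
`c₄` (here `16`) and a family `M n` of `{∧₂, ∨₂, 0, 1}`-circuits with `|M n| ≤ 2^{c₄ ⌊log₂ n⌋²}`
eventually such that for every `δ ∈ (0,1/2)` the type-I error on `G(n,1/2)` plus the type-II error on
the planted `⌈n^{1/2-δ}⌉`-clique tends to `0` — the exact monotone `CLIQUE(n, 3⌊log₂ n⌋+3)` circuit.
[folklore] -/
theorem stub_bruteForce :
    ∃ c₄ : ℕ, ∃ M : (n : ℕ) → Circuit ((⊤ : SimpleGraph (Fin n)).edgeSet),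
      (∀ᶠ n : ℕ in atTop, (M n).IsOver monotoneBasis01 ∧ (M n).size ≤ 2 ^ (c₄ * Nat.log 2 n ^ 2)) ∧
      ∀ δ : ℝ, 0 < δ → δ < 1 / 2 →
        Tendsto (fun n : ℕ =>
            (erdosRenyiHalf n).toOuterMeasure {x | (M n).eval x = true} +
              (plantedCliqueDist n ⌈(n : ℝ) ^ (1 / 2 - δ)⌉₊).toOuterMeasure {x | (M n).eval x = false})
          atTop (nhds 0) := by
  classical
  -- the clique size `t n = 3 ⌊log₂ n⌋ + 3` and the family (junk outside the range `t n ≤ n`)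
  set t : ℕ → ℕ := fun n => 3 * Nat.log 2 n + 3 with ht
  let P : (n : ℕ) → Prop := fun n => 2 ≤ t n ∧ t n ≤ n
  let M : (n : ℕ) → Circuit ((⊤ : SimpleGraph (Fin n)).edgeSet) := fun n =>
    if h : P n then (exists_sized_monotone_cliqueCircuit h.1 h.2).choose else Circuit.const _ false
  have ht_logb : ∀ n : ℕ, (2 + 1) * Real.logb 2 (n : ℝ) ≤ (t n : ℝ) := by
    intro n
    rcases Nat.eq_zero_or_pos n with hn | hn
    · subst hn
      simp [t]
    · have hlt : (n : ℝ) < (2 : ℝ) ^ ((Nat.log 2 n + 1 : ℕ) : ℝ) := by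
        rw [Real.rpow_natCast]
        exact_mod_cast Nat.lt_pow_succ_log_self (by norm_num : 1 < 2) n
      have hlogb : Real.logb 2 (n : ℝ) < ((Nat.log 2 n + 1 : ℕ) : ℝ) :=
        (Real.logb_lt_iff_lt_rpow (by norm_num) (by exact_mod_cast hn)).2 hlt
      have : (t n : ℝ) = 3 * ((Nat.log 2 n + 1 : ℕ) : ℝ) := by
        simp only [t]; push_cast; ring
      rw [this]
      linarith
  -- `t n ≤ n` eventually (take `β = 1/4` in the growth lemma)
  have htn : ∀ᶠ n : ℕ in atTop, t n ≤ n :=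
    (eventually_three_log_le_rpow (β := 1 / 4) (by norm_num) (by norm_num)).mono fun n h => h.2
  have hMP : ∀ᶠ n : ℕ in atTop, (M n).IsOver monotoneBasis ∧
      (M n).size ≤ n.choose (t n) * (n.choose 2 + 1) ∧ ∀ x, (M n).eval x = cliqueFn n (t n) x := by
    filter_upwards [htn] with n hg
    have hP : P n := ⟨by simp [t], hg⟩
    have hM : M n = (exists_sized_monotone_cliqueCircuit hP.1 hP.2).choose := dif_pos hP
    rw [hM]
    exact (exists_sized_monotone_cliqueCircuit hP.1 hP.2).choose_spec
  refine ⟨16, M, ?_, ?_⟩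
  · filter_upwards [hMP, eventually_ge_atTop 2] with n hn hn2
    refine ⟨hn.1.mono monotoneBasis_subset_monotoneBasis01, hn.2.1.trans ?_⟩
    exact (choose_mul_choose_two_succ_le_pow n (t n) (by omega)).trans (pow_three_log_add_five_le n hn2)
  · intro δ hδ hδ'
    have hgrow : ∀ᶠ n : ℕ in atTop, t n ≤ ⌈(n : ℝ) ^ (1 / 2 - δ)⌉₊ ∧ t n ≤ n :=
      eventually_three_log_le_rpow (β := 1 / 2 - δ) (by linarith) (by linarith)
    -- type-I error → 0
    have hI : Tendsto (fun n : ℕ =>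
        (erdosRenyiHalf n).toOuterMeasure {x | (M n).eval x = true}) atTop (nhds 0) := by
      have hE' := plantedClique_erdosRenyiNoLargeClique_proof t ⟨1, one_pos, Eventually.of_forall ht_logb⟩
      refine hE'.congr' ?_
      filter_upwards [hMP] with n hn
      congr 1
      ext x
      simp only [Set.mem_setOf_eq]
      rw [hn.2.2 x]
      exact (cliqueFn_eq_true_iff_exists_isClique x).symm
    -- type-II error = 0 eventually
    have hII : ∀ᶠ n : ℕ in atTop,
        (plantedCliqueDist n ⌈(n : ℝ) ^ (1 / 2 - δ)⌉₊).toOuterMeasure {x | (M n).eval x = false} = 0 := by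
      filter_upwards [hMP, hgrow] with n hn hg
      rw [PMF.toOuterMeasure_apply_eq_zero_iff, Set.disjoint_left]
      intro x hx hxf
      rw [plantedCliqueDist, PMF.support_map] at hx
      obtain ⟨p, hp, rfl⟩ := hx
      obtain ⟨hcard, hcl⟩ := mem_support_plantedCliqueJoint hp
      have hle : t n ≤ p.1.card := by rw [hcard]; exact le_min hg.1 hg.2
      obtain ⟨S, hSsub, hScard⟩ := Finset.exists_subset_card_eq hle
      have hclS : (graphOfEdgeVec p.2).IsClique (S : Set (Fin n)) :=
        hcl.subset (by exact_mod_cast hSsub)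
      have htrue : (M n).eval p.2 = true := by
        rw [hn.2.2]
        exact (cliqueFn_eq_true_iff_exists_isClique p.2).2 ⟨S, hScard, hclS⟩
      simp only [Set.mem_setOf_eq] at hxf
      rw [htrue] at hxf
      exact Bool.noConfusion hxf
    refine hI.congr' ?_
    filter_upwards [hII] with n hn
    rw [hn, add_zero]

end Summit.PneNP.PneNP.Theorems.MonotoneSuffices.SliceTransport
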